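import Summits.Parity.GeneralizedHardyLittlewood.Theorems.BeyondDiagonalBeatsQuarter.OffDiagLevelAPBridge
import Literature.NumberTheory.Sieve.PolymathThetaLevel
import HarnessLib

/-!
# Route `PrimeLevelFamEdge`, crux K_B (stmt-Parity-20343), line `diagonal_kernel_split` rev 4, plan Ω (KEYS-NEXT S2,
# complement) — **the level-AP bridge in `E_π`- and `ψ`-currency**

`OffDiagLevelAPBridge` (p647977) bounds `levelDeviation Q F n a` over the primes of a block `(N, M]` by partial summation
against the COUNT deviations, in the `π`-discrepancy currency `primeCountingDisc n a y` (one class, with an `ω(n)/φ(n)`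
term for the primes dividing `n`). This complement adds the two other currencies the level-distribution inputs of the
Ω-blueprint are PRINTED in, reusing that file's Abel identity (`sum_mul_eq_abel`, `levelDeviation_eq_sum_weight`,
`norm_levelDeviation_le_of_deriv`, `sum_norm_sub_succ_le_of_deriv`, `primesIoc_filter_le`):

* §1 `norm_levelDeviation_le_of_forall_units` — ANY `Q, F` and any class-independent `μ`:
  `‖levelDeviation Q F n a‖ ≤ 2·max_{b unit} ‖levelAPSum Q F n b − μ‖` (the principal part IS the average of the
  unit-class sums, `sum_units_levelAPSum`; no `ω(n)/φ(n)` term).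
* §2 Abel summation with a SECOND weight `H` kept inside the truncations (needed for `H = log`):
  `levelDeviation_mul_eq_abel` (`levelDeviation Q (G·H) = G(M)·levelDeviation Q H − Σ_{i∈(N,M−1]} (G(i+1) − G i)·
  levelDeviation Q_{≤i} H`), `norm_levelDeviation_mul_le`, `norm_levelDeviation_smooth_mul_le` (`C¹` weight `g`,
  `‖g′‖ ≤ B` on `[N, M]`: `≤ (‖g M‖ + (M−N)·B)·D`).
* §3 (`E_π`) `levelAPSum_primes_one_eq`: `levelAPSum (primes of (N,t]) 1 n b = π(t;n,b) − π(N;n,b)`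
  (`LevelOfDistribution.primeCountingMod`); `norm_levelDeviation_primes_one_le_of_forall_units` (any main term);
  `norm_levelDeviation_primes_one_le_errMax` (`≤ 4·E_π(X;n)`, `E_π = primeCountingAPErrMax`, the summand of
  `PrimesHaveLevelPi`); **`norm_levelDeviation_primes_le_errMax`**:
  `‖levelDeviation (primes of (N,M]) g n a‖ ≤ 4·E_π(M; n)·(‖g M‖ + (M−N)·B)` (`1 ≤ n`, `a` unit, `1 ≤ N ≤ M`).
* §4 (`ψ`) `levelAPSum_primes_log_eq`: `levelAPSum (primes of (N,t]) log n b = (ψ − R)(t;n,b) − (ψ − R)(N;n,b)`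
  (`ψ = LevelOfDistribution.chebyshevPsiMod`, `rfl`-equal to the `ParityWave0.chebyshevPsiMod` of `siegel_walfisz`
  (`chebyshevPsiMod_eq_wave0`); `R = chebyshevPsiModNotPrime ≤ ψ − ϑ ≤ 2√x log x`, Mathlib `Chebyshev.psi_sub_theta_le`);
  `norm_levelDeviation_primes_log_le_of_psi`; **`norm_levelDeviation_primes_mul_log_le_of_psi`**: if
  `|ψ(y;n,b) − y/φ(n)| ≤ E` for all units `b` and integers `N ≤ y ≤ M`, then
  `‖levelDeviation (primes of (N,M]) (g·log) n a‖ ≤ (‖g M‖ + (M−N)·B)·(4E + 4√M·log M)`.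

No new definitions; standard axioms. Helper toward `stub_offDiagBelowSlack_io` (a8S/L8 and the level-sum deviations of
OMEGA-BLUEPRINT v4 §3c); closes nothing by itself.
«The programme SEARCHES and TYPES; no claim about Landau–Siegel zeros, Theorems 1–2 of arXiv:2211.02515 or
a repaired Margin232 until a kernel theorem says so.»
-/

noncomputable section

open Finset

namespace Summit.Parity.GeneralizedHardyLittlewood.Theorems.BeyondDiagonalBeatsQuarter.OffDiag

open Literature.NumberTheory.Sieve

/-! ### §1 The deviation against an arbitrary class-independent main term -/

/-- **Deviation ≤ twice the worst class, against any common main term.** For `n ≥ 1`, a unit class `a`, any `Q`, `F`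
and ANY `μ ∈ ℂ`: if `‖Σ_{q∈Q, q≡b} F − μ‖ ≤ E` for every unit class `b`, then `‖levelDeviation Q F n a‖ ≤ 2E` — the
principal part is the average of the unit-class sums, `levelDeviation = (S_a − μ) − φ(n)⁻¹ Σ_b (S_b − μ)`. [folklore] -/
theorem norm_levelDeviation_le_of_forall_units (Q : Finset ℕ) (F : ℕ → ℂ) {n : ℕ} [NeZero n] (a : (ZMod n)ˣ)
    (μ : ℂ) {E : ℝ} (hE : ∀ u : (ZMod n)ˣ, ‖levelAPSum Q F n (u : ZMod n) - μ‖ ≤ E) :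
    ‖levelDeviation Q F n (a : ZMod n)‖ ≤ 2 * E := by
  classical
  have hφpos : 0 < Nat.totient n := Nat.totient_pos.mpr (NeZero.pos n)
  have hφ : (Nat.totient n : ℂ) ≠ 0 := by exact_mod_cast hφpos.ne'
  have hcard : (Finset.univ : Finset (ZMod n)ˣ).card = Nat.totient n := by
    rw [Finset.card_univ, ZMod.card_units_eq_totient]
  have key : levelDeviation Q F n (a : ZMod n) =
      (levelAPSum Q F n a - μ) -
        (Nat.totient n : ℂ)⁻¹ * ∑ u : (ZMod n)ˣ, (levelAPSum Q F n (u : ZMod n) - μ) := by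
    rw [levelDeviation, levelPrincipal, ← sum_units_levelAPSum Q F n, Finset.sum_sub_distrib, Finset.sum_const,
      hcard, nsmul_eq_mul, mul_sub, ← mul_assoc, inv_mul_cancel₀ hφ, one_mul]
    ring
  have h2 : ‖(Nat.totient n : ℂ)⁻¹ * ∑ u : (ZMod n)ˣ, (levelAPSum Q F n (u : ZMod n) - μ)‖ ≤ E := by
    rw [norm_mul, norm_inv, Complex.norm_natCast,
      inv_mul_le_iff₀ (by exact_mod_cast hφpos : (0 : ℝ) < (Nat.totient n : ℝ))]
    refine (norm_sum_le _ _).trans ?_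
    calc ∑ u : (ZMod n)ˣ, ‖levelAPSum Q F n (u : ZMod n) - μ‖ ≤ ∑ _u : (ZMod n)ˣ, E :=
          Finset.sum_le_sum fun u _ ↦ hE u
      _ = (Nat.totient n : ℝ) * E := by rw [Finset.sum_const, hcard, nsmul_eq_mul]
  rw [key]
  refine (norm_sub_le _ _).trans ?_
  linarith [hE a, h2]

/-! ### §2 Abel summation keeping a second weight inside the truncations -/

open Classical in
/-- **Abel summation for the deviation of a product weight** over `Q ⊆ (N, M]`:
`levelDeviation Q (G·H) n a = G(M)·levelDeviation Q H n a − Σ_{i∈(N,M−1]} (G(i+1) − G(i))·levelDeviation Q_{≤i} H n a`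
(`Q_{≤i} = Q.filter (· ≤ i)`; `OffDiagLevelAPBridge.sum_mul_eq_abel` with the weight `(1_{≡a} − φ⁻¹1_{unit})·H`).
[folklore] -/
theorem levelDeviation_mul_eq_abel {Q : Finset ℕ} {N M : ℕ} (hQ : Q ⊆ Ioc N M) (G H : ℕ → ℂ) (n : ℕ)
    (a : ZMod n) :
    levelDeviation Q (fun q ↦ G q * H q) n a =
      G M * levelDeviation Q H n a -
        ∑ i ∈ Ioc N (M - 1), (G (i + 1) - G i) * levelDeviation (Q.filter (· ≤ i)) H n a := by
  obtain ⟨wt, hwt⟩ : ∃ wt : ℕ → ℂ, ∀ (S : Finset ℕ) (K : ℕ → ℂ),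
      levelDeviation S K n a = ∑ q ∈ S, wt q * K q :=
    ⟨_, fun S K ↦ levelDeviation_eq_sum_weight S K n a⟩
  rw [hwt Q (fun q ↦ G q * H q), hwt Q H]
  simp_rw [hwt _ H]
  have hre : ∑ q ∈ Q, wt q * (G q * H q) = ∑ q ∈ Q, (wt q * H q) * G q :=
    Finset.sum_congr rfl fun q _ ↦ by ring
  rw [hre, sum_mul_eq_abel hQ (fun q ↦ wt q * H q) G]

/-- **The partial-summation bound for the deviation (second weight kept).** For `Q ⊆ (N, M]`, `N ≤ M`, and `D` with
`‖levelDeviation Q_{≤i} H n a‖ ≤ D` for all `N ≤ i ≤ M`: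
`‖levelDeviation Q (G·H) n a‖ ≤ (‖G(M)‖ + Σ_{i∈(N,M−1]} ‖G(i+1) − G(i)‖)·D`. [folklore] -/
theorem norm_levelDeviation_mul_le {Q : Finset ℕ} {N M : ℕ} (hQ : Q ⊆ Ioc N M) (hNM : N ≤ M) (G H : ℕ → ℂ)
    (n : ℕ) (a : ZMod n) {D : ℝ} (hD : ∀ i ∈ Icc N M, ‖levelDeviation (Q.filter (· ≤ i)) H n a‖ ≤ D) :
    ‖levelDeviation Q (fun q ↦ G q * H q) n a‖ ≤ (‖G M‖ + ∑ i ∈ Ioc N (M - 1), ‖G (i + 1) - G i‖) * D := by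
  rw [levelDeviation_mul_eq_abel hQ G H n a]
  have hM : ‖levelDeviation Q H n a‖ ≤ D := by
    have := hD M (Finset.mem_Icc.mpr ⟨hNM, le_rfl⟩)
    rwa [filter_le_eq_self_of_subset_Ioc hQ] at this
  calc ‖G M * levelDeviation Q H n a -
        ∑ i ∈ Ioc N (M - 1), (G (i + 1) - G i) * levelDeviation (Q.filter (· ≤ i)) H n a‖
      ≤ ‖G M * levelDeviation Q H n a‖ +
          ‖∑ i ∈ Ioc N (M - 1), (G (i + 1) - G i) * levelDeviation (Q.filter (· ≤ i)) H n a‖ := norm_sub_le _ _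
    _ ≤ ‖G M‖ * D + ∑ i ∈ Ioc N (M - 1), ‖G (i + 1) - G i‖ * D := by
        refine add_le_add ?_ ((norm_sum_le _ _).trans (Finset.sum_le_sum fun i hi ↦ ?_))
        · rw [norm_mul]; exact mul_le_mul_of_nonneg_left hM (norm_nonneg _)
        · rw [norm_mul]
          have hi' : i ∈ Icc N M := by
            rw [Finset.mem_Ioc] at hi; exact Finset.mem_Icc.mpr ⟨hi.1.le, by omega⟩
          exact mul_le_mul_of_nonneg_left (hD i hi') (norm_nonneg _)
    _ = (‖G M‖ + ∑ i ∈ Ioc N (M - 1), ‖G (i + 1) - G i‖) * D := by rw [← Finset.sum_mul]; ring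

/-- **The partial-summation bound with a `C¹` weight (second weight kept).** For `Q ⊆ (N, M]` (`N ≤ M`), `g`
differentiable at every point of `[N, M]` with `‖g′‖ ≤ B`, and `‖levelDeviation Q_{≤i} H n a‖ ≤ D` (`D ≥ 0`) for
`N ≤ i ≤ M`: `‖levelDeviation Q (g·H) n a‖ ≤ (‖g(M)‖ + (M − N)·B)·D` (`sum_norm_sub_succ_le_of_deriv`). [folklore] -/
theorem norm_levelDeviation_smooth_mul_le {Q : Finset ℕ} {N M : ℕ} (hQ : Q ⊆ Ioc N M) (hNM : N ≤ M)
    {g : ℝ → ℂ} {B : ℝ} (hg : ∀ t ∈ Set.Icc (N : ℝ) M, DifferentiableAt ℝ g t)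
    (hB : ∀ t ∈ Set.Icc (N : ℝ) M, ‖deriv g t‖ ≤ B) (H : ℕ → ℂ) (n : ℕ) (a : ZMod n) {D : ℝ} (hD0 : 0 ≤ D)
    (hD : ∀ i ∈ Icc N M, ‖levelDeviation (Q.filter (· ≤ i)) H n a‖ ≤ D) :
    ‖levelDeviation Q (fun q ↦ g q * H q) n a‖ ≤ (‖g M‖ + ((M : ℝ) - N) * B) * D := by
  refine (norm_levelDeviation_mul_le hQ hNM (fun q ↦ g q) H n a hD).trans ?_
  have := sum_norm_sub_succ_le_of_deriv hNM hg hB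
  gcongr

/-! ### §3 The primes of a block: counts in a class, `E_π`-currency -/

/-- **The count in a class is a difference of `π(·; n, b)`**: for `N ≤ t`,
`levelAPSum (primes of (N,t]) 1 n b = π(t; n, b) − π(N; n, b)` (`π(x; q, a) = LevelOfDistribution.primeCountingMod`,
class `b` read through `b.val`). [folklore] -/
theorem levelAPSum_primes_one_eq {n : ℕ} [NeZero n] (b : ZMod n) {N t : ℕ} (hNt : N ≤ t) :
    levelAPSum ((Ioc N t).filter Nat.Prime) (fun _ ↦ (1 : ℂ)) n b =
      (((LevelOfDistribution.primeCountingMod n b.val t : ℝ) -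
        (LevelOfDistribution.primeCountingMod n b.val N : ℝ) : ℝ) : ℂ) := by
  classical
  have hiff : ∀ p : ℕ, p ≡ b.val [MOD n] ↔ (p : ZMod n) = b := fun p ↦ by
    rw [← ZMod.natCast_eq_natCast_iff, ZMod.natCast_zmod_val]
  set c : ℕ := ((Ioc N t).filter (fun m : ℕ ↦ m.Prime ∧ (m : ZMod n) = b)).card with hc
  have hL : levelAPSum ((Ioc N t).filter Nat.Prime) (fun _ ↦ (1 : ℂ)) n b = (c : ℂ) := by
    rw [levelAPSum, Finset.sum_const, nsmul_eq_mul, mul_one, Finset.filter_filter]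
  have hπ : ∀ x : ℕ, LevelOfDistribution.primeCountingMod n b.val x =
      ∑ m ∈ Ico 0 (x + 1), if m.Prime ∧ (m : ZMod n) = b then 1 else 0 := by
    intro x
    rw [LevelOfDistribution.primeCountingMod, Finset.card_filter, Finset.range_eq_Ico]
    exact Finset.sum_congr rfl fun m _ ↦ by simp only [hiff]
  have hsplit : LevelOfDistribution.primeCountingMod n b.val t =
      LevelOfDistribution.primeCountingMod n b.val N + c := by
    rw [hπ, hπ, hc, Finset.card_filter, ← Finset.Ico_add_one_add_one_eq_Ioc]
    exact (Finset.sum_Ico_consecutive _ (Nat.zero_le (N + 1)) (by omega : N + 1 ≤ t + 1)).symm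
  rw [hL, hsplit]
  push_cast
  ring

/-- **Count deviation against ANY common main term** `μ`: if `|π(t;n,b) − π(N;n,b) − μ| ≤ E` for every unit class `b`
(`n ≥ 1`, `a` unit, `N ≤ t`), then `‖levelDeviation (primes of (N,t]) 1 n a‖ ≤ 2E`. [folklore] -/
theorem norm_levelDeviation_primes_one_le_of_forall_units {n : ℕ} [NeZero n] (a : (ZMod n)ˣ) {N t : ℕ}
    (hNt : N ≤ t) (μ : ℝ) {E : ℝ} (hE : ∀ u : (ZMod n)ˣ,
      |(LevelOfDistribution.primeCountingMod n (u : ZMod n).val t : ℝ) -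
          (LevelOfDistribution.primeCountingMod n (u : ZMod n).val N : ℝ) - μ| ≤ E) :
    ‖levelDeviation ((Ioc N t).filter Nat.Prime) (fun _ ↦ (1 : ℂ)) n a‖ ≤ 2 * E := by
  refine norm_levelDeviation_le_of_forall_units _ _ a (μ : ℂ) fun u ↦ ?_
  rw [levelAPSum_primes_one_eq (u : ZMod n) hNt, ← Complex.ofReal_sub, Complex.norm_real, Real.norm_eq_abs]
  exact hE u

/-- **Count deviation in `E_π`-currency**: for `1 ≤ n`, a unit `a`, `1 ≤ N ≤ t ≤ X`: `‖levelDeviation (primes of (N,t])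
1 n a‖ ≤ 4·E_π(X; n)` (`E_π = primeCountingAPErrMax`, summand of `PrimesHaveLevelPi`; `μ = (π(t) − π(N))/φ(n)`). [folklore] -/
theorem norm_levelDeviation_primes_one_le_errMax {n : ℕ} (hn : 1 ≤ n) (a : (ZMod n)ˣ) {N t : ℕ} (hN : 1 ≤ N)
    (hNt : N ≤ t) {X : ℝ} (htX : (t : ℝ) ≤ X) :
    ‖levelDeviation ((Ioc N t).filter Nat.Prime) (fun _ ↦ (1 : ℂ)) n a‖ ≤ 4 * primeCountingAPErrMax X n := by
  haveI : NeZero n := ⟨by omega⟩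
  have hNX : (N : ℝ) ≤ X := le_trans (by exact_mod_cast hNt) htX
  have h := norm_levelDeviation_primes_one_le_of_forall_units a hNt
    (((Nat.primeCounting t : ℝ) - Nat.primeCounting N) / Nat.totient n) (E := 2 * primeCountingAPErrMax X n)
    fun u ↦ ?_
  · linarith
  · have ht := abs_sub_le_primeCountingAPErrMax (y := (t : ℝ)) (by exact_mod_cast hN.trans hNt) htX hn u
    have hN' := abs_sub_le_primeCountingAPErrMax (y := (N : ℝ)) (by exact_mod_cast hN) hNX hn u
    rw [Nat.floor_natCast] at ht hN'
    rw [abs_le] at ht hN' ⊢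
    constructor
    · rw [sub_div]; linarith [ht.1, hN'.2]
    · rw [sub_div]; linarith [ht.2, hN'.1]

/-- **THE `E_π`-CURRENCY BRIDGE.** For `1 ≤ n`, a unit class `a`, `1 ≤ N ≤ M` and a weight `g` differentiable at every
point of `[N, M]` with `‖g′‖ ≤ B` there: `‖levelDeviation (primes of (N,M]) g n a‖ ≤ 4·E_π(M; n)·(‖g(M)‖ + (M − N)·B)`
(summed over `n ≤ M^{θ−ε}`, `E_π(M; n)` is what `PrimesHaveLevelPi θ` / Bombieri–Vinogradov in `π`-form bounds;
`OffDiagLevelAPBridge.norm_levelDeviation_le_of_deriv` does the partial summation). [folklore] -/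
theorem norm_levelDeviation_primes_le_errMax {n : ℕ} (hn : 1 ≤ n) (a : (ZMod n)ˣ) {N M : ℕ} (hN : 1 ≤ N)
    (hNM : N ≤ M) {g : ℝ → ℂ} {B : ℝ} (hg : ∀ t ∈ Set.Icc (N : ℝ) M, DifferentiableAt ℝ g t)
    (hB : ∀ t ∈ Set.Icc (N : ℝ) M, ‖deriv g t‖ ≤ B) :
    ‖levelDeviation ((Ioc N M).filter Nat.Prime) (fun q : ℕ ↦ g q) n (a : ZMod n)‖ ≤
      4 * primeCountingAPErrMax M n * (‖g M‖ + ((M : ℝ) - N) * B) := by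
  refine norm_levelDeviation_le_of_deriv n (Finset.filter_subset _ _) hNM (a : ZMod n)
    (mul_nonneg (by norm_num) (primeCountingAPErrMax_nonneg _ _)) hg hB fun i hi ↦ ?_
  rw [Finset.mem_Ioc] at hi
  rw [primesIoc_filter_le hi.2]
  exact norm_levelDeviation_primes_one_le_errMax hn a hN hi.1.le (by exact_mod_cast hi.2)

/-! ### §4 The primes of a block: `θ`-counts in a class, `ψ`-currency -/

/-- **The `θ`-count in a class is a difference of `(ψ − R)(·; n, b)`**, `R` = the prime-power part of `ψ(·; n, b)`
(`chebyshevPsiModNotPrime`): `levelAPSum (primes of (N,t]) log n b = (ψ − R)(t;n,b) − (ψ − R)(N;n,b)`, `N ≤ t`. [folklore] -/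
theorem levelAPSum_primes_log_eq {n : ℕ} (b : ZMod n) {N t : ℕ} (hNt : N ≤ t) :
    levelAPSum ((Ioc N t).filter Nat.Prime) (fun q ↦ ((Real.log q : ℝ) : ℂ)) n b =
      (((LevelOfDistribution.chebyshevPsiMod n b t - chebyshevPsiModNotPrime n b t) -
        (LevelOfDistribution.chebyshevPsiMod n b N - chebyshevPsiModNotPrime n b N) : ℝ) : ℂ) := by
  classical
  have hθ : ∀ x : ℕ, LevelOfDistribution.chebyshevPsiMod n b x - chebyshevPsiModNotPrime n b x =
      ∑ m ∈ Ico 0 (x + 1), if m.Prime ∧ (m : ZMod n) = b then Real.log m else 0 := by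
    intro x
    rw [chebyshevPsiMod_natCast, chebyshevPsiModNotPrime, ← Finset.sum_sub_distrib, Finset.range_eq_Ico]
    refine Finset.sum_congr rfl fun m _ ↦ ?_
    by_cases hp : m.Prime
    · rw [if_pos hp, sub_zero, ArithmeticFunction.vonMangoldt_apply_prime hp, apIndicator]
      by_cases hb : (m : ZMod n) = b
      · rw [if_pos hb, if_pos ⟨hp, hb⟩, one_mul]
      · rw [if_neg hb, if_neg (fun h ↦ hb h.2), zero_mul]
    · rw [if_neg hp, sub_self, if_neg (fun h ↦ hp h.1)]
  have hsplit : (LevelOfDistribution.chebyshevPsiMod n b t - chebyshevPsiModNotPrime n b t) -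
      (LevelOfDistribution.chebyshevPsiMod n b N - chebyshevPsiModNotPrime n b N) =
        ∑ m ∈ Ioc N t, if m.Prime ∧ (m : ZMod n) = b then Real.log m else 0 := by
    rw [hθ, hθ, ← Finset.Ico_add_one_add_one_eq_Ioc,
      ← Finset.sum_Ico_consecutive _ (Nat.zero_le (N + 1)) (by omega : N + 1 ≤ t + 1), add_sub_cancel_left]
  rw [hsplit, levelAPSum, Finset.filter_filter, Finset.sum_filter]
  push_cast
  refine Finset.sum_congr rfl fun m _ ↦ ?_
  split_ifs <;> simp

/-- **`θ`-count deviation in `ψ`-currency**: for `1 ≤ n`, a unit `a`, `1 ≤ N ≤ t`, and `|ψ(y; n, b) − y/φ(n)| ≤ E` for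
all units `b` and integers `N ≤ y ≤ t` (what `siegel_walfisz` gives pointwise): `‖levelDeviation (primes of (N,t]) log n a‖
≤ 4E + 4√t·log t` (prime powers: `R_b(t) ≤ ψ(t) − ϑ(t) ≤ 2√t log t`, Mathlib; main term `(t − N)/φ(n)`). [folklore] -/
theorem norm_levelDeviation_primes_log_le_of_psi {n : ℕ} (hn : 1 ≤ n) (a : (ZMod n)ˣ) {N t : ℕ} (hN : 1 ≤ N)
    (hNt : N ≤ t) {E : ℝ}
    (hψ : ∀ u : (ZMod n)ˣ, ∀ y : ℕ, N ≤ y → y ≤ t →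
      |LevelOfDistribution.chebyshevPsiMod n (u : ZMod n) y - (y : ℝ) / Nat.totient n| ≤ E) :
    ‖levelDeviation ((Ioc N t).filter Nat.Prime) (fun q ↦ ((Real.log q : ℝ) : ℂ)) n a‖ ≤
      4 * E + 4 * Real.sqrt t * Real.log t := by
  haveI : NeZero n := ⟨by omega⟩
  have ht1 : (1 : ℝ) ≤ t := by exact_mod_cast hN.trans hNt
  have h := norm_levelDeviation_le_of_forall_units ((Ioc N t).filter Nat.Prime)
    (fun q ↦ ((Real.log q : ℝ) : ℂ)) a ((((t : ℝ) - N) / Nat.totient n : ℝ) : ℂ)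
    (E := 2 * E + 2 * Real.sqrt t * Real.log t) fun u ↦ ?_
  · linarith
  · rw [levelAPSum_primes_log_eq (u : ZMod n) hNt, ← Complex.ofReal_sub, Complex.norm_real, Real.norm_eq_abs]
    have h1 := hψ u t hNt le_rfl
    have h2 := hψ u N le_rfl hNt
    have hR0 : 0 ≤ chebyshevPsiModNotPrime n (u : ZMod n) N := chebyshevPsiModNotPrime_nonneg _ _ _
    have hRm : chebyshevPsiModNotPrime n (u : ZMod n) N ≤ chebyshevPsiModNotPrime n (u : ZMod n) t :=
      chebyshevPsiModNotPrime_mono _ _ hNt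
    have hRt : chebyshevPsiModNotPrime n (u : ZMod n) t ≤ 2 * Real.sqrt t * Real.log t :=
      (chebyshevPsiModNotPrime_le _ _ _).trans (Chebyshev.psi_sub_theta_le ht1)
    rw [abs_le] at h1 h2 ⊢
    constructor
    · rw [sub_div]; linarith [h1.1, h2.2]
    · rw [sub_div]; linarith [h1.2, h2.1]

/-- **THE `ψ`-CURRENCY BRIDGE.** For `1 ≤ n`, a unit class `a`, `1 ≤ N ≤ M`, `g` differentiable at every point of
`[N, M]` with `‖g′‖ ≤ B`, and `|ψ(y; n, b) − y/φ(n)| ≤ E` for all units `b` and integers `N ≤ y ≤ M` (`ψ` =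
`LevelOfDistribution.chebyshevPsiMod`, `rfl`-equal to `ParityWave0.chebyshevPsiMod` of `siegel_walfisz`):
`‖levelDeviation (primes of (N,M]) (g·log) n a‖ ≤ (‖g(M)‖ + (M − N)·B)·(4E + 4√M·log M)`. [folklore] -/
theorem norm_levelDeviation_primes_mul_log_le_of_psi {n : ℕ} (hn : 1 ≤ n) (a : (ZMod n)ˣ) {N M : ℕ} (hN : 1 ≤ N)
    (hNM : N ≤ M) {g : ℝ → ℂ} {B : ℝ} (hg : ∀ t ∈ Set.Icc (N : ℝ) M, DifferentiableAt ℝ g t)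
    (hB : ∀ t ∈ Set.Icc (N : ℝ) M, ‖deriv g t‖ ≤ B) {E : ℝ}
    (hψ : ∀ u : (ZMod n)ˣ, ∀ y : ℕ, N ≤ y → y ≤ M →
      |LevelOfDistribution.chebyshevPsiMod n (u : ZMod n) y - (y : ℝ) / Nat.totient n| ≤ E) :
    ‖levelDeviation ((Ioc N M).filter Nat.Prime) (fun q ↦ g q * ((Real.log q : ℝ) : ℂ)) n (a : ZMod n)‖ ≤
      (‖g M‖ + ((M : ℝ) - N) * B) * (4 * E + 4 * Real.sqrt M * Real.log M) := by
  haveI : NeZero n := ⟨by omega⟩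
  have hE0 : 0 ≤ E := (abs_nonneg _).trans (hψ 1 N le_rfl hNM)
  have hM1 : (1 : ℝ) ≤ M := by exact_mod_cast hN.trans hNM
  have hD0 : 0 ≤ 4 * E + 4 * Real.sqrt M * Real.log M := by have := Real.log_nonneg hM1; positivity
  refine norm_levelDeviation_smooth_mul_le (Finset.filter_subset Nat.Prime _) hNM hg hB
    (fun q ↦ ((Real.log q : ℝ) : ℂ)) n (a : ZMod n) hD0 fun i hi ↦ ?_
  rw [Finset.mem_Icc] at hi
  rw [primesIoc_filter_le hi.2]
  have hi1 : (1 : ℝ) ≤ i := by exact_mod_cast hN.trans hi.1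
  have hiM : (i : ℝ) ≤ M := by exact_mod_cast hi.2
  refine (norm_levelDeviation_primes_log_le_of_psi hn a hN hi.1
    (fun u y hy1 hy2 ↦ hψ u y hy1 (hy2.trans hi.2))).trans ?_
  have hl : Real.log i ≤ Real.log M := Real.log_le_log (by linarith) hiM
  have hl0 : 0 ≤ Real.log (i : ℝ) := Real.log_nonneg hi1
  gcongr

end Summit.Parity.GeneralizedHardyLittlewood.Theorems.BeyondDiagonalBeatsQuarter.OffDiag
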